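import Summits.NavierStokesRegularity.NavierStokesRegularity.Theses.AxisymmetricExtremality
import Summits.NavierStokesRegularity.NavierStokesRegularity.Theorems.AxisymmetricExtremalityAxisymmetricKatoGlobalStubSeregin2020TypeIIOffAxisRepr
import HarnessLib

/-!
# Seregin 2020, proof of Thm 2.1, the no-swirl endgame: the smooth, axisymmetric, swirl-free
# representative on open sets of regular points

Helper toward the stub `stub_seregin2020TypeII` of the crux `AxisymmetricKatoGlobal` (= the named
fact `Literature.Analysis.FluidPDE.Seregin2020_axisymmetricSingularPoint_typeII`, G. Seregin,
Anal. Math. Phys. 10 (2020) Paper 46 = arXiv:2006.04140, Thm 2.1). The last step of the printed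
proof (arXiv p. 8: "any axially symmetric suitable weak solution with no swirl … is smooth … by
considering a problem for `η = ω_φ/ϱ`") is run, in the tree's rendering, as a local maximum
principle for `η` (`Literature.Analysis.FluidPDE.noSwirl_abs_scalar_le_of_boundary`) on a
cylinder all of whose points below the top time are REGULAR points, possibly on the axis. That
tool consumes a classical object: slices `C^∞` in space, axisymmetric and swirl free at every
point. The sibling `exists_isSmoothAxisymmetricSolutionOn_of_offAxis` produces the smooth
axisymmetric representative (the Seregin–Zajaczkowski 2007 class
`IsSmoothAxisymmetricSolutionOn`) on OFF-AXIS regions, where regularity is automatic; this file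
records the same passage on an arbitrary open, rotation invariant set of regular points
(`exists_isSmoothAxisymmetricSolutionOn_of_regular`), the pointwise vanishing of the swirl of
the continuous representative of an a.e. swirl-free field (`swirl_repr_eq_zero_of_ae`), and the
packaged form for a pair in Albritton–Barker's class on a ball `Q(a)` with axisymmetric,
swirl-free slices — the swirl-free normal form of the blow-up limit
(`exists_smooth_noSwirl_repr_of_inBall`).

## References

* G. Seregin, Anal. Math. Phys. 10 (2020), Paper 46 = arXiv:2006.04140, proof of Thm. 2.1, last
  paragraph (arXiv p. 8) with the structure of the singular set (p. 7). [Seregin2020]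
* G. Seregin, W. Zajaczkowski, SIAM J. Math. Anal. 39 (2007) 669–685, §3. [SereginZajaczkowski2007]
-/

-- the problem directory repeats the summit name (D-0017); core's `dupNamespace` linter fires
set_option linter.dupNamespace false

noncomputable section

open MeasureTheory Set Function Filter Topology TopologicalSpace Metric
open scoped NNReal ENNReal

namespace Summit.NavierStokesRegularity.NavierStokesRegularity.Theorems.AxisymmetricKatoGlobal.EulerScaling

open Literature.Analysis.FluidPDE Literature.Analysis.FluidPDE.SereginZajaczkowski2007
  Literature.Analysis.FluidPDE.SereginSverak2009

/-- **On an open, rotation invariant set of regular points, an axisymmetric suitable weak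
solution is a "sufficiently smooth axially symmetric solution".** Let `(u, p)` be a suitable
weak solution of the unforced Navier–Stokes system (`ν = 1`) on an open `Q ⊆ ℝ × ℝ³` with
axisymmetric slices at the times of `Q`, and let `S ⊆ Q` be open, invariant under
`(t, x) ↦ (t, R_θ x)`, and consist of regular points of `u`. Then `u` has a representative `V` on
`S` with `(V, p)` in the class `SereginZajaczkowski2007.IsSmoothAxisymmetricSolutionOn S`
(suitable on `S`, axisymmetric at every point of `S`, slices `C^∞` at the points of `S`, all
spatial derivatives locally Hölder continuous in space–time). Same proof as the off-axis case:
local essential boundedness at regular points, `NSBoundedHigherRegularity_holds`, transport of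
suitability and pointwise symmetry of the continuous representative.
[cite: Seregin2020, proof of Thm 2.1, structure of the singular set (arXiv p. 7)] -/
theorem exists_isSmoothAxisymmetricSolutionOn_of_regular
    {Q S : Opens (ℝ × EuclideanSpace ℝ (Fin 3))}
    {u : ℝ → EuclideanSpace ℝ (Fin 3) → EuclideanSpace ℝ (Fin 3)}
    {p : ℝ → EuclideanSpace ℝ (Fin 3) → ℝ}
    (hsw : IsSuitableWeakSolutionOn Q 1 0 u p)
    (hax : ∀ z ∈ (Q : Set (ℝ × EuclideanSpace ℝ (Fin 3))), IsAxisymmetric (u z.1))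
    (hSQ : S ≤ Q)
    (hSreg : ∀ z ∈ (S : Set (ℝ × EuclideanSpace ℝ (Fin 3))), IsRegularPoint u z)
    (hSrot : ∀ θ : ℝ, ∀ z ∈ (S : Set (ℝ × EuclideanSpace ℝ (Fin 3))),
      ((z.1, rotZ θ z.2) : ℝ × EuclideanSpace ℝ (Fin 3)) ∈
        (S : Set (ℝ × EuclideanSpace ℝ (Fin 3)))) :
    ∃ V : ℝ → EuclideanSpace ℝ (Fin 3) → EuclideanSpace ℝ (Fin 3),
      IsSmoothAxisymmetricSolutionOn S V p ∧
        uncurry u =ᵐ[volume.restrict (S : Set (ℝ × EuclideanSpace ℝ (Fin 3)))] uncurry V := by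
  have hSo : IsOpen (S : Set (ℝ × EuclideanSpace ℝ (Fin 3))) := S.isOpen
  have hsol : IsDistributionalNSSolutionOn S 1 0 u p := hsw.distributional.of_le hSQ
  -- regular points: `u` is locally essentially bounded on `S`
  have hbd : ∀ z ∈ (S : Set (ℝ × EuclideanSpace ℝ (Fin 3))), ∃ N ∈ 𝓝 z, ∃ M : ℝ,
      ∀ᵐ w ∂(volume.restrict N), ‖u w.1 w.2‖ ≤ M := fun z hz =>
    exists_nhds_ae_norm_le_of_isRegularPoint (hSreg z hz)
  -- `p ∈ L^{3/2}` near every point (compact neighbourhoods inside `Q`)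
  have hp : ∀ z ∈ (S : Set (ℝ × EuclideanSpace ℝ (Fin 3))), ∃ N ∈ 𝓝 z,
      ∫⁻ w in N, ‖p w.1 w.2‖ₑ ^ (3 / 2 : ℝ) < ∞ := by
    intro z hz
    obtain ⟨K, hKc, hzK, hKQ⟩ := exists_compact_subset Q.isOpen (hSQ hz)
    exact ⟨K, mem_interior_iff_mem_nhds.1 hzK, hsw.pressure K hKQ hKc⟩
  obtain ⟨V, hae, hVc, hCD, hHol⟩ :=
    NSBoundedHigherRegularity_holds.exists_smooth_representative hsol hbd hp
  have hsuit : IsSuitableWeakSolutionOn S 1 0 V p :=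
    (hsw.of_le hSQ).congr_ae hae (Eventually.of_forall fun _ => rfl)
  have haxi : IsAxisymmetricOn (S : Set (ℝ × EuclideanSpace ℝ (Fin 3))) V :=
    isAxisymmetricOn_of_ae_eq hSo hSrot (fun z hz θ => hax z (hSQ hz) θ z.2) hVc hae
  refine ⟨V, ⟨hsuit, haxi, hCD, fun n z hz => ?_⟩, hae⟩
  obtain ⟨N, hNo, hzN, -, C, α, hα, hHN⟩ := hHol n z hz
  exact ⟨N, hNo.mem_nhds hzN, C, α, hα, hHN.mono inter_subset_left⟩

/-- **The continuous representative of an a.e. swirl-free field is swirl free at every point of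
the open set**: if `V` is in the class on `S`, `u = V` a.e. on `S` and `swirl (u t) x = 0` for
a.e. `(t, x) ∈ S`, then `swirl (V t) x = 0` for EVERY `(t, x) ∈ S` (a continuous function
vanishing a.e. on an open set vanishes there). [folklore] -/
theorem swirl_repr_eq_zero_of_ae
    {S : Opens (ℝ × EuclideanSpace ℝ (Fin 3))}
    {u V : ℝ → EuclideanSpace ℝ (Fin 3) → EuclideanSpace ℝ (Fin 3)}
    {p : ℝ → EuclideanSpace ℝ (Fin 3) → ℝ}
    (hV : IsSmoothAxisymmetricSolutionOn S V p)
    (hae : uncurry u =ᵐ[volume.restrict (S : Set (ℝ × EuclideanSpace ℝ (Fin 3)))] uncurry V)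
    (hns : ∀ᵐ z ∂(volume.restrict (S : Set (ℝ × EuclideanSpace ℝ (Fin 3)))),
      swirl (u z.1) z.2 = 0) :
    ∀ z ∈ (S : Set (ℝ × EuclideanSpace ℝ (Fin 3))), swirl (V z.1) z.2 = 0 := by
  have hSo : IsOpen (S : Set (ℝ × EuclideanSpace ℝ (Fin 3))) := S.isOpen
  -- the swirl of `V` vanishes a.e. on `S`
  have h0 : (fun z : ℝ × EuclideanSpace ℝ (Fin 3) => swirl (V z.1) z.2) =ᵐ[volume.restrict
      (S : Set (ℝ × EuclideanSpace ℝ (Fin 3)))] fun _ => (0 : ℝ) := by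
    filter_upwards [hae, hns] with z hz hz0
    have e : u z.1 z.2 = V z.1 z.2 := hz
    have : swirl (V z.1) z.2 = swirl (u z.1) z.2 := by simp only [swirl, e]
    rw [this, hz0]
  -- and is continuous on `S`
  have hc : ContinuousOn (fun z : ℝ × EuclideanSpace ℝ (Fin 3) => swirl (V z.1) z.2)
      (S : Set (ℝ × EuclideanSpace ℝ (Fin 3))) := by
    have hVc := hV.continuousOn_velocity
    have h1 : ContinuousOn (fun z : ℝ × EuclideanSpace ℝ (Fin 3) => (uncurry V z) 1) (S : Set _) :=
      ((EuclideanSpace.proj (1 : Fin 3)).continuous).comp_continuousOn hVc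
    have h0' : ContinuousOn (fun z : ℝ × EuclideanSpace ℝ (Fin 3) => (uncurry V z) 0) (S : Set _) :=
      ((EuclideanSpace.proj (0 : Fin 3)).continuous).comp_continuousOn hVc
    have hx0 : Continuous fun z : ℝ × EuclideanSpace ℝ (Fin 3) => z.2 0 :=
      (EuclideanSpace.proj (0 : Fin 3)).continuous.comp continuous_snd
    have hx1 : Continuous fun z : ℝ × EuclideanSpace ℝ (Fin 3) => z.2 1 :=
      (EuclideanSpace.proj (1 : Fin 3)).continuous.comp continuous_snd
    exact (hx0.continuousOn.mul h1).sub (hx1.continuousOn.mul h0')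
  exact fun z hz => Measure.eqOn_open_of_ae_eq h0 hSo hc continuousOn_const hz

/-- **The packaged form for the swirl-free normal form of the blow-up limit.** Let `(w, π)` be a
suitable weak solution in Albritton–Barker's class on `Q(a)` with every slice `w s`
axisymmetric and swirl free (pointwise), and let `S ⊆ Q(a)` be open, rotation invariant and made
of regular points of `w`. Then `w` has on `S` a representative `V` in the class
`IsSmoothAxisymmetricSolutionOn S V π` whose swirl vanishes at every point of `S` — the
classical swirl-free axisymmetric object of the `η = ω_φ/ϱ` maximum principle.
[cite: Seregin2020, proof of Thm 2.1, last paragraph] -/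
theorem exists_smooth_noSwirl_repr_of_inBall :
    ∀ (w : ℝ → EuclideanSpace ℝ (Fin 3) → EuclideanSpace ℝ (Fin 3))
      (π : ℝ → EuclideanSpace ℝ (Fin 3) → ℝ) (a : ℝ), IsSuitableWeakSolutionInBall a 0 w π →
      (∀ s, IsAxisymmetric (w s)) → (∀ s, HasNoSwirl (w s)) →
      ∀ S : Opens (ℝ × EuclideanSpace ℝ (Fin 3)),
        S ≤ parabolicCylinderOpens a (0 : ℝ × EuclideanSpace ℝ (Fin 3)) →
        (∀ z ∈ (S : Set (ℝ × EuclideanSpace ℝ (Fin 3))), IsRegularPoint w z) →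
        (∀ θ : ℝ, ∀ z ∈ (S : Set (ℝ × EuclideanSpace ℝ (Fin 3))),
          ((z.1, rotZ θ z.2) : ℝ × EuclideanSpace ℝ (Fin 3)) ∈
            (S : Set (ℝ × EuclideanSpace ℝ (Fin 3)))) →
        ∃ V : ℝ → EuclideanSpace ℝ (Fin 3) → EuclideanSpace ℝ (Fin 3),
          IsSmoothAxisymmetricSolutionOn S V π ∧
          uncurry w =ᵐ[volume.restrict (S : Set (ℝ × EuclideanSpace ℝ (Fin 3)))] uncurry V ∧
          ∀ z ∈ (S : Set (ℝ × EuclideanSpace ℝ (Fin 3))), swirl (V z.1) z.2 = 0 := by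
  intro w π a hball hax hns S hSQ hSreg hSrot
  obtain ⟨V, hV, hae⟩ := exists_isSmoothAxisymmetricSolutionOn_of_regular hball.1
    (fun z _ => hax z.1) hSQ hSreg hSrot
  exact ⟨V, hV, hae, swirl_repr_eq_zero_of_ae hV hae (Eventually.of_forall fun z => hns z.1 z.2)⟩

end Summit.NavierStokesRegularity.NavierStokesRegularity.Theorems.AxisymmetricKatoGlobal.EulerScaling

end
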